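import Literature.AlgebraicGeometry.Motives.MixedHodgeStructure
import HarnessLib

/-!
# Weight bounds and Hodge-type bounds of a mixed `ℚ`-Hodge structure

Two predicates on the tree's `Literature.AlgebraicGeometry.Motives.MixedHodgeStructure`, the
Hodge-theoretic input of the weight and Hodge co-level filtrations on formal periods
(`HodgeColevelFiltration.lean`, definition request `defn-HodgeColevelFiltration` of route
`KontsevichZagierPeriods/HodgeColevel`):

* `MixedHodgeStructure.WeightsLE H w`: **all weights of `H` are `≤ w`**, i.e. `W_w V = V`;
  for the (finite, increasing) weight filtration of a mixed Hodge structure this is equivalent to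
  `j ≤ w` for every weight `j` of `H` in the sense of `MixedHodgeStructure.IsWeight`
  (`W_{j-1} < W_j`, i.e. `Gr^W_j ≠ 0`; Deligne, *Hodge II*, 2.3.1; for Nori motives
  Huber–Müller-Stach, draft III, Prop. 10.4.5): `weightsLE_iff_forall_isWeight`.
* `MixedHodgeStructure.HodgeTypesLE H c`: **all Hodge types of `H` are `≤ c`**: every non-zero
  Hodge piece `(Gr^W_{p+q} V)^{p,q}` — every `(p, q)` with `h^{p,q}(H) ≠ 0`, Deligne, *Hodge III*,
  8.2.4 — has `max p q ≤ c` (types in the box `(-∞, c]²`; for effective structures `[0, c]²`).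
  This `c` is the *co-level* bound of the request, not the level `|p - q|` of Grothendieck 1969
  (the tree's `HodgeStructure.level`).

Both are upward closed (`WeightsLE.mono`, `HodgeTypesLE.mono`); every mixed Hodge structure has
bounded weights (`exists_weightsLE`); a pure Hodge structure `H₀` of weight `n`, regarded as a
mixed one (`HodgeStructure.toMixedHodgeStructure`), has weights `≤ w` for `n ≤ w`
(`weightsLE_toMixedHodgeStructure`) and has Hodge types `≤ c` iff its non-zero pieces `V^{p,q}`
have `max p q ≤ c` (`hodgeTypesLE_toMixedHodgeStructure_iff`, through the order isomorphism
`grOrderIso` transporting subspaces of `V_ℂ` to subspaces of `ℂ ⊗ Gr^W_n V`).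

## References

* P. Deligne, *Théorie de Hodge II*, Publ. IHÉS 40 (1971), 2.3.1; *Théorie de Hodge III*,
  Publ. IHÉS 44 (1974), 8.2.4.
* A. Huber, S. Müller-Stach, *Periods and Nori Motives, Part III* (draft 2015), Prop. 10.4.5
  (= Springer 2017, Ch. 10: the weight filtration on Nori motives).
-/

noncomputable section

namespace Literature.AlgebraicGeometry.Motives

universe u w

open scoped TensorProduct

namespace MixedHodgeStructure

variable {V : Type u} [AddCommGroup V] [Module ℚ V] (H : MixedHodgeStructure V)

/-! ### The two predicates -/

/-- **All weights of `H` are `≤ w`**: `W_w V = V`. For the (finite, increasing) weight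
filtration of a mixed Hodge structure this says exactly that every weight `j` of `H`
(`MixedHodgeStructure.IsWeight`: `W_{j-1} < W_j`, i.e. `Gr^W_j ≠ 0`; Deligne, Hodge II, 2.3.1;
Huber–Müller-Stach draft III, Prop. 10.4.5 for Nori motives) satisfies `j ≤ w`
(`weightsLE_iff_forall_isWeight`). [folklore] -/
def WeightsLE (w : ℤ) : Prop :=
  H.W w = ⊤

/-- **All Hodge types of `H` are `≤ c`** (have `max p q ≤ c`): every non-zero Hodge piece
`(Gr^W_{p+q} V)^{p,q}` of every graded piece — i.e. every `(p, q)` with `h^{p,q}(H) ≠ 0` in the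
sense of Deligne, Hodge III, 8.2.4 ("les nombres de Hodge de `Gr^W`"), cf. the tree's
`MixedHodgeStructure.hodgeNumber` — satisfies `p ≤ c` and `q ≤ c`: the Hodge types lie in the
box `(-∞, c]²` (for effective structures, in `[0, c]²`). The bound `c` is the *co-level* datum of
route `HodgeColevel` (as opposed to the level `|p - q|` of Grothendieck 1969, the tree's
`HodgeStructure.level`). [folklore] -/
def HodgeTypesLE (c : ℤ) : Prop :=
  ∀ p q : ℤ, (H.gr (p + q)).piece p q ≠ ⊥ → max p q ≤ c

variable {H}

/-- Unfolding `WeightsLE`. [folklore] -/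
theorem weightsLE_iff {w : ℤ} : H.WeightsLE w ↔ H.W w = ⊤ :=
  Iff.rfl

/-- Unfolding `HodgeTypesLE`. [folklore] -/
theorem hodgeTypesLE_iff {c : ℤ} :
    H.HodgeTypesLE c ↔ ∀ p q : ℤ, (H.gr (p + q)).piece p q ≠ ⊥ → max p q ≤ c :=
  Iff.rfl

/-- Weight bounds are upward closed (the weight filtration is increasing). [folklore] -/
theorem WeightsLE.mono {w w' : ℤ} (h : H.WeightsLE w) (hw : w ≤ w') : H.WeightsLE w' :=
  top_unique (h.symm.le.trans (H.monotone_W hw))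

/-- Hodge-type bounds are upward closed. [folklore] -/
theorem HodgeTypesLE.mono {c c' : ℤ} (h : H.HodgeTypesLE c) (hc : c ≤ c') : H.HodgeTypesLE c' :=
  fun p q hpq => (h p q hpq).trans hc

variable (H) in
/-- Every mixed Hodge structure has bounded weights (its weight filtration is exhaustive). [folklore] -/
theorem exists_weightsLE : ∃ w, H.WeightsLE w :=
  H.exists_W_eq_top

/-- If all weights are `≤ w`, every weight `j` of `H` (`W_{j-1} < W_j`) satisfies `j ≤ w`:
above `w` the filtration is constant, equal to `V`. [folklore] -/
theorem WeightsLE.le_of_isWeight {w : ℤ} (h : H.WeightsLE w) {j : ℤ} (hj : H.IsWeight j) :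
    j ≤ w := by
  by_contra hjw
  have h' : H.W (j - 1) = ⊤ := h.mono (by omega)
  exact not_top_lt (h' ▸ hj : (⊤ : Submodule ℚ V) < H.W j)

/-- Conversely, if every weight of `H` is `≤ w` then `W_w = V`: descend from an exhausting step
`W_N = V` one index at a time (`¬ (W_{j-1} < W_j)` and `W_{j-1} ≤ W_j` give `W_{j-1} = W_j`). [folklore] -/
theorem weightsLE_of_forall_isWeight {w : ℤ} (h : ∀ j, H.IsWeight j → j ≤ w) :
    H.WeightsLE w := by
  -- one step of the descent
  have step : ∀ j, w < j → H.W j = ⊤ → H.W (j - 1) = ⊤ := by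
    intro j hj hWj
    have hnw : ¬ H.IsWeight j := fun hw => absurd (h j hw) (not_le.2 hj)
    have hle : H.W (j - 1) ≤ H.W j := H.monotone_W (by omega)
    have : H.W (j - 1) = H.W j := by
      by_contra hne
      exact hnw (hle.lt_of_ne hne)
    rw [this, hWj]
  obtain ⟨N, hN⟩ := H.exists_W_eq_top
  by_cases hNw : N ≤ w
  · exact top_unique (hN.symm.le.trans (H.monotone_W hNw))
  · have key : ∀ n : ℕ, H.W (w + n) = ⊤ → H.W w = ⊤ := by
      intro n
      induction n with
      | zero => simp
      | succ n ih =>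
        intro hn
        refine ih ?_
        have := step (w + (n + 1 : ℕ)) (by omega) hn
        rwa [show w + ((n + 1 : ℕ) : ℤ) - 1 = w + (n : ℕ) by push_cast; ring] at this
    obtain ⟨n, rfl⟩ : ∃ n : ℕ, N = w + n := ⟨(N - w).toNat, by omega⟩
    exact key n hN

/-- **All weights `≤ w` iff every weight of `H` is `≤ w`.** [folklore] -/
theorem weightsLE_iff_forall_isWeight {w : ℤ} :
    H.WeightsLE w ↔ ∀ j, H.IsWeight j → j ≤ w :=
  ⟨fun h _ hj => h.le_of_isWeight hj, weightsLE_of_forall_isWeight⟩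

end MixedHodgeStructure

/-! ### Pure Hodge structures regarded as mixed ones -/

namespace HodgeStructure

open MixedHodgeStructure

variable {V : Type u} [AddCommGroup V] [Module ℚ V] {n : ℤ} (H₀ : HodgeStructure V n)

/-- A pure Hodge structure of weight `n`, regarded as a mixed Hodge structure, has all its weights
`≤ w` as soon as `n ≤ w` (its weight filtration is `V` from `n` on). [folklore] -/
theorem weightsLE_toMixedHodgeStructure {w : ℤ} (h : n ≤ w) :
    H₀.toMixedHodgeStructure.WeightsLE w :=
  trivialWeightFiltration_of_le h

/-- At `n`, the inclusion `ℂ ⊗ W_n → V_ℂ` of the trivial weight filtration is bijective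
(`W_n = V`). [folklore] -/
theorem bijective_grIncl_toMixedHodgeStructure :
    Function.Bijective (grIncl H₀.toMixedHodgeStructure.W n) := by
  refine ⟨grIncl_injective _ n, LinearMap.baseChange_surjective ℂ fun v => ?_⟩
  exact ⟨⟨v, by rw [toMixedHodgeStructure_W, trivialWeightFiltration_of_le le_rfl]; trivial⟩, rfl⟩

/-- At `n`, the projection `ℂ ⊗ W_n → ℂ ⊗ Gr^W_n` of the trivial weight filtration is bijective
(`W_{n-1} = 0`, and `ℂ` is flat over `ℚ`). [folklore] -/
theorem bijective_grProj_toMixedHodgeStructure :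
    Function.Bijective (grProj H₀.toMixedHodgeStructure.W n) := by
  refine ⟨baseChange_injective ?_, grProj_surjective _ n⟩
  rw [← LinearMap.ker_eq_bot, Submodule.ker_mkQ, subPiece, toMixedHodgeStructure_W,
    toMixedHodgeStructure_W, trivialWeightFiltration_of_lt (sub_one_lt n), Submodule.submoduleOf,
    Submodule.comap_bot, Submodule.ker_subtype]

/-- Off weight `n`, the graded pieces of the trivial weight filtration vanish. [folklore] -/
theorem subsingleton_grW_toMixedHodgeStructure {k : ℤ} (hk : k ≠ n) :
    Subsingleton (grW H₀.toMixedHodgeStructure.W k) := by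
  rcases lt_or_gt_of_ne hk with hk | hk
  · -- `k < n`: `W_k = 0`
    haveI : Subsingleton ↥(H₀.toMixedHodgeStructure.W k) := by
      rw [toMixedHodgeStructure_W, trivialWeightFiltration_of_lt hk]
      infer_instance
    exact (Submodule.mkQ_surjective _).subsingleton
  · -- `n < k`: `W_{k-1} = W_k = V`
    rw [Submodule.Quotient.subsingleton_iff, subPiece, Submodule.submoduleOf,
      Submodule.comap_subtype_eq_top, toMixedHodgeStructure_W, toMixedHodgeStructure_W,
      trivialWeightFiltration_of_le (show n ≤ k - 1 by omega)]
    exact le_top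

/-- The complexification of a zero `ℚ`-vector space is zero. [folklore] -/
theorem subsingleton_complexified {M : Type w} [AddCommGroup M] [Module ℚ M] [Subsingleton M] :
    Subsingleton (ℂ ⊗[ℚ] M) := by
  refine subsingleton_of_forall_eq 0 fun x => ?_
  induction x using TensorProduct.induction_on with
  | zero => rfl
  | tmul c m => rw [Subsingleton.elim m 0, TensorProduct.tmul_zero]
  | add x y hx hy => rw [hx, hy, add_zero]

/-- For a pure Hodge structure `H₀` of weight `n` regarded as a mixed one (trivial weight
filtration at `n`, so that `ι_n : ℂ ⊗ W_n → V_ℂ` and `π_n : ℂ ⊗ W_n → ℂ ⊗ Gr^W_n` are bijective),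
the transport `S ↦ π_n (ι_n⁻¹ S)` of `ℂ`-subspaces of `V_ℂ` to `ℂ`-subspaces of `ℂ ⊗ Gr^W_n V` is
an order isomorphism (Mathlib's `Submodule.orderIsoMapComapOfBijective`, twice). [folklore] -/
def grOrderIso :
    Submodule ℂ (ℂ ⊗[ℚ] V) ≃o Submodule ℂ (ℂ ⊗[ℚ] grW H₀.toMixedHodgeStructure.W n) :=
  (Submodule.orderIsoMapComapOfBijective (grIncl H₀.toMixedHodgeStructure.W n)
      H₀.bijective_grIncl_toMixedHodgeStructure).symm.trans
    (Submodule.orderIsoMapComapOfBijective (grProj H₀.toMixedHodgeStructure.W n)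
      H₀.bijective_grProj_toMixedHodgeStructure)

/-- `grOrderIso` is `S ↦ map π_n (comap ι_n S)` (by `rfl`). [folklore] -/
theorem grOrderIso_apply (S : Submodule ℂ (ℂ ⊗[ℚ] V)) :
    H₀.grOrderIso S = (S.comap (grIncl H₀.toMixedHodgeStructure.W n)).map
      (grProj H₀.toMixedHodgeStructure.W n) :=
  rfl

/-- On `Gr^W_n` of a pure Hodge structure `H₀` of weight `n` (regarded as a mixed Hodge
structure), the Hodge piece `(p, q)`, `p + q = n`, is the transport of the piece `V^{p,q}` of
`H₀`. [folklore] -/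
theorem gr_piece_toMixedHodgeStructure {p q : ℤ} (hpq : p + q = n) :
    (H₀.toMixedHodgeStructure.gr n).piece p q = H₀.grOrderIso (H₀.piece p q) := by
  rw [piece_of_add_eq _ hpq, piece_of_add_eq _ hpq, OrderIso.map_inf, grOrderIso_apply,
    grOrderIso_apply, gr_F, gr_F, complexConj_grF]
  rfl

/-- Hence that piece vanishes iff `V^{p,q} = 0`. [folklore] -/
theorem gr_piece_toMixedHodgeStructure_eq_bot_iff {p q : ℤ} (hpq : p + q = n) :
    (H₀.toMixedHodgeStructure.gr n).piece p q = ⊥ ↔ H₀.piece p q = ⊥ := by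
  rw [gr_piece_toMixedHodgeStructure H₀ hpq, ← H₀.grOrderIso.map_bot, H₀.grOrderIso.injective.eq_iff]

/-- Off weight `n` the graded pieces, hence all their Hodge pieces, vanish. [folklore] -/
theorem gr_piece_toMixedHodgeStructure_of_ne {k : ℤ} (hk : k ≠ n) (p q : ℤ) :
    (H₀.toMixedHodgeStructure.gr k).piece p q = ⊥ := by
  haveI := H₀.subsingleton_grW_toMixedHodgeStructure hk
  haveI : Subsingleton (ℂ ⊗[ℚ] grW H₀.toMixedHodgeStructure.W k) := subsingleton_complexified
  exact (Submodule.eq_bot_iff _).2 fun x _ => Subsingleton.elim x 0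

/-- **The Hodge types of a pure Hodge structure, regarded as a mixed one, are those of its
non-zero pieces `V^{p,q}`**:
`H₀.toMixedHodgeStructure.HodgeTypesLE c ↔ (V^{p,q} ≠ 0 → max p q ≤ c)`. E.g. a structure purely
of type `(m, m)` (the Hodge structure of `ℚ(-m)`, of `(2πi)^m`) on `V ≠ 0` has Hodge types `≤ c`
iff `m ≤ c`. [folklore] -/
theorem hodgeTypesLE_toMixedHodgeStructure_iff {c : ℤ} :
    H₀.toMixedHodgeStructure.HodgeTypesLE c ↔ ∀ p q : ℤ, H₀.piece p q ≠ ⊥ → max p q ≤ c := by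
  constructor
  · intro h p q hpq
    have hn : p + q = n := by
      by_contra hne
      exact hpq (H₀.piece_eq_bot_of_add_ne hne)
    subst hn
    exact h p q (by rwa [Ne, gr_piece_toMixedHodgeStructure_eq_bot_iff H₀ rfl])
  · intro h p q hpq
    by_cases hn : p + q = n
    · subst hn
      rw [Ne, gr_piece_toMixedHodgeStructure_eq_bot_iff H₀ rfl] at hpq
      exact h p q hpq
    · exact absurd (gr_piece_toMixedHodgeStructure_of_ne H₀ hn p q) hpq

end HodgeStructure

end Literature.AlgebraicGeometry.Motives

end
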